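import Summits.Ventures.CertifiedManyBodySolver.Downfold.EmeryShapeWindowClosure
import Summits.Ventures.CertifiedManyBodySolver.Downfold.EmeryFermiScalePointsLa214VirtualCorners
import Summits.Ventures.CertifiedManyBodySolver.Downfold.EmeryFermiScalePointsLa214Corners
import Summits.Ventures.CertifiedManyBodySolver.Downfold.EmeryBoxesCuprates
import HarnessLib

/-!
# THE ONE-BAND FERMI-SURFACE SHAPE `t′/t` OF THE WHOLE TYPED La₂CuO₄ 3BE BOX FROM TWO VIRTUAL CORNERS (two-ray rule + window closure, §B.86)

Venture CertifiedManyBodySolver, cell `pub/hubbard-downfold` (stage S1; INFLATION-RULES-3to1-B §B.86 (h)), seat hubbard-downfold-mod-4 (technique B, g35); namespace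
`Summit.Ventures.CertifiedManyBodySolver.Downfold.Emery`. Everything PROVED (0 sorry). WHAT THIS IS NOT: a statement about La₂CuO₄ — the box `emeryBoxLa214`
(box #18, router/BOXES/La2CuO4-family.md «THREE-BAND (3BE) COMPANION BOX») is SCREENING-GRADE; `U = 0` one-body kinematics of the σ model (object E = the EXACT
`t–t′` shape of the σ Fermi surface, `EmeryFermiSurfaceShape`); no interaction, no `t″`.

For EVERY one-body row `(Δ, t_pd, t_pp, t_pp′) ∈ [1.7, 4] × [1.29, 1.52] × [0.46, 0.66] × [0.12, 0.15]` eV and the LSCO fillings below, the one-band `t′/t` of the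
σ-model Fermi surface AT THAT ROW'S OWN FERMI ENERGY lies in the window of the table. Device: the two-ray rule `EmeryShapeTwoRayRule` (levers Δ ↑, t_pd ↑,
oxygen ray ↓ — certificate-free) squeezes every member between two rows on its own oxygen ray; the window closure `EmeryShapeWindowClosure` collapses them at
fixed energy onto the VIRTUAL CORNERS `V_lo = (1.7, 1.29, 0.66, 99/460 ≈ 0.215)` and `V_hi = (4, 1.52, 0.46, 23/275 ≈ 0.084)` (t_pp′ OUTSIDE the typed range by
the factor b₂/b₁ = 33/23: the explicit 3 → 1 inflation of technique B for this coordinate) and reads `fsRatio` there over certified energy windows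
(`EmeryFermiScalePointsLa214VirtualCorners`: K = 384 `pointBracketCheck`s at V_lo, V_hi and the auxiliary row A_lo = (1.7, 1.29, 0.66, 0.12)). The upper window is
monotone (doping discriminant ≤ 0 at V_hi: U = fsRatio(V_hi; e₄)); the lower window is monotone at x = 1/8, 0.22 (L = fsRatio(V_lo; e₁)) and NOT at x = 0, where
the discriminant changes sign at ε ≈ 1.90 eV and the Lipschitz-in-energy bound of §B.86 (e) is used (price < 2·10⁻⁴).

| filling (LSCO column) | certified window for t′/t over the WHOLE box | V_lo: ε_F bracket, fsRatio | V_hi: ε_F bracket, fsRatio | lower closure | true-corner preview (64² grid, screening) |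
|---|---|---|---|---|---|
| x = 0 (ν = 1/2; column M13) | **[-0.3091, -0.1583]** | [1.8939, 1.9089] eV, [-0.3094, -0.3084] | [1.6628, 1.6728] eV, [-0.1586, -0.1583] | Lipschitz: dd ∈ [-0.0052, 0.1583] on the window, M = 0.1584, price 1.2e-04 | [−0.2915, −0.1675] |
| x = 1/8 (ν = 7/16; M15 centre) | **[-0.3091, -0.159]** | [1.7397, 1.7547] eV, [-0.3095, -0.3085] | [1.565, 1.575] eV, [-0.1593, -0.1590] | monotone: L = fsRatio(V_lo; e₁) | [−0.2925, −0.1681] |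
| x = 0.22 (ν = 39/100; M17 centre) | **[-0.3093, -0.1595]** | [1.6446, 1.6546] eV, [-0.3096, -0.3089] | [1.4993, 1.5093] eV, [-0.1598, -0.1595] | monotone: L = fsRatio(V_lo; e₁) | [−0.2932, −0.1685] |

True-corner preview = the screening values at the TRUE box corners (Δ₁, a₁, b₂, c₂) and (Δ₂, a₂, b₁, c₁) of a 64² zone grid (scaling-g35/explore/numcheck.py):
the virtual-corner inflation of this device is ≈ 0.017 (low end) + 0.009 (high end) of t′/t, i.e. ≈ 20 % of the window width — the price of not signing
the `t_pp` direction at fixed `t_pp′ > 0` (§B.85 (l)); it vanishes for pure (`t_pp′ = 0`) and fixed-ratio boxes (`EmeryShapeTwoRayRule` §2–§3).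
COMPARISON WITH THE SUB-BOX DEVICE OF RECORD (router/EMERY-FS-WINDOWS.tsv, g19, `EmeryFermiFillingLa214*`: Δ × t_pd sub-boxes × K = 24 grid certificates,
t_pp′ treated at fixed energy): x = 0 [−0.2955, −0.1653], x = 1/8 [−0.2964, −0.1661] — TIGHTER than the two-virtual-corner window by 0.014 / 0.007, and
INSIDE it (consistency check of both devices). The two-ray device is the STRUCTURAL one: three certificate-free levers + three point certificates per filling,
EXACT for pure (`t_pp′ = 0`) and fixed-ratio boxes; for a general box the b₂/b₁ inflation of t_pp′ is its explicit price (§B.85 (l)); the x = 0.22 row is new.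
READING: the window is dominated by the oxygen coordinates (t_pp, t_pp′), not by Δ (whose 2.4× width moves t′/t by only ≈ 0.06 at fixed oxygen) — cf. the
band-level single-band box of INFL-3to1-B for La₂CuO₄, t′/t ∈ [−0.170, −0.048] (whole-window fits): object E (the EXACT shape at the Fermi surface) is
MORE t′-negative over the same three-band box, −0.31 … −0.16.

Sources: three-band model [HybertsenSchluterChristensen1989, Eq. (1)]; [AndersenEtAl1995, §6]; box rows as cited in `EmeryBoxesCuprates`.
-/

noncomputable section

namespace Summit.Ventures.CertifiedManyBodySolver.Downfold.Emery

open Real Set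

/-- **x = 0 (ν = 1/2; column M13): for every row of the La₂CuO₄ 3BE box the one-band Fermi-surface `t′/t` (object E, at the row's own Fermi energy) lies in `[-0.3091, -0.1583]`.** Lower closure: lipschitz. [folklore] -/
theorem la214Box_fsRatio_x0 {Δ a b c : ℝ} (hΔ : Δ ∈ Icc ((17 : ℝ) / 10) 4) (ha : a ∈ Icc ((129 : ℝ) / 100) ((38 : ℝ) / 25)) (hb : b ∈ Icc ((23 : ℝ) / 50) ((33 : ℝ) / 50)) (hc : c ∈ Icc ((3 : ℝ) / 25) ((3 : ℝ) / 20)) :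
    fsRatio Δ a b c (fermiEnergyOf Δ a b c ((1 : ℝ) / 2)) ∈ Icc ((-3091 : ℝ) / 10000) ((-1583 : ℝ) / 10000) := by
  have hV : ((3 : ℝ) / 20) * ((33 : ℝ) / 50) / ((23 : ℝ) / 50) = (99 : ℝ) / 460 := by norm_num
  have hW : ((3 : ℝ) / 25) * ((23 : ℝ) / 50) / ((33 : ℝ) / 50) = (23 : ℝ) / 275 := by norm_num
  -- certificates (K = 384 point brackets)
  have hVlo := (fermiEnergyOf_of_pointBracketCheck virtPt_la214Vlo_x0_br (by norm_num) (by norm_num) (by norm_num) (ν := (1/2 : ℝ)) (by push_cast; exact ⟨le_rfl, le_rfl⟩)).2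
  have hVhi := (fermiEnergyOf_of_pointBracketCheck virtPt_la214Vhi_x0_br (by norm_num) (by norm_num) (by norm_num) (ν := (1/2 : ℝ)) (by push_cast; exact ⟨le_rfl, le_rfl⟩)).2
  have hAlo := (fermiEnergyOf_of_pointBracketCheck virtPt_la214Alo_x0_br (by norm_num) (by norm_num) (by norm_num) (ν := (1/2 : ℝ)) (by push_cast; exact ⟨le_rfl, le_rfl⟩)).2
  have hTop := (fermiEnergyOf_of_pointBracketCheck cornerPt_la214BoxHi_x0_br (by norm_num) (by norm_num) (by norm_num) (ν := (1/2 : ℝ)) (by push_cast; exact ⟨le_rfl, le_rfl⟩)).2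
  push_cast at hVlo hVhi hAlo hTop
  norm_num at hVlo hVhi hAlo hTop
  refine fsRatio_fermiEnergyOf_mem_Icc_windowClosure (Δ₁ := (17 : ℝ) / 10) (Δ₂ := 4) (a₁ := (129 : ℝ) / 100) (a₂ := (38 : ℝ) / 25) (b₁ := (23 : ℝ) / 50)
    (b₂ := (33 : ℝ) / 50) (c₁ := (3 : ℝ) / 25) (c₂ := (3 : ℝ) / 20) (e₁ := ((18939 : ℝ) / 10000)) (e₂ := ((9987 : ℝ) / 5000)) (e₃ := 0) (e₄ := ((2091 : ℝ) / 1250)) (by norm_num) (by norm_num) (by norm_num) (by norm_num)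
    (by norm_num) hΔ ha hb hc (by norm_num) (by norm_num) ?_ ?_ ?_ (by norm_num) ?_ ?_ ?_ (by norm_num) ?_
  · -- regime at the box's Fermi-energy high corner (g34 certificate): c₂ b₂ ε_F(Δ₁, a₂, b₂, c₁) ≤ a₁² b₁
    nlinarith [hTop.2]
  · rw [hV]; exact hVlo.1
  · exact hAlo.2
  · intro ε hε
    rw [hV]
    have hlip := fsRatio_ge_on_window (Δ := (17 : ℝ) / 10) (a := (129 : ℝ) / 100) (b := (33 : ℝ) / 50) (c := (99 : ℝ) / 460) (p := ((18939 : ℝ) / 10000)) (q := ((9987 : ℝ) / 5000))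
      (M := ((99 : ℝ) / 625)) (by norm_num) (by norm_num) (by norm_num) (by norm_num) (by norm_num [fsD, fsN]) (by norm_num [dopingDisc]) (by norm_num [dopingDisc]) hε
    refine le_trans ?_ hlip
    norm_num [fsRatio, fsD, fsN]
  · exact (fermiEnergyOf_pos (by norm_num) (by norm_num) (by norm_num) (by norm_num) (by norm_num) (by norm_num)).le
  · rw [hW]; exact hVhi.2
  · intro ε hε
    rw [hW]
    have hmono := (fsRatio_mem_Icc_on_window_of_dopingDisc_nonpos (Δ := (4 : ℝ)) (a := (38 : ℝ) / 25) (b := (23 : ℝ) / 50) (c := (23 : ℝ) / 275)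
      (p := 0) (q := ((2091 : ℝ) / 1250)) (by norm_num) (by norm_num) (by norm_num) (by norm_num) (by norm_num) (by norm_num) (by norm_num)
      (by norm_num [dopingDisc]) hε).2
    refine le_trans hmono ?_
    norm_num [fsRatio, fsD, fsN]

/-- **x = 1/8 (ν = 7/16; M15 centre): for every row of the La₂CuO₄ 3BE box the one-band Fermi-surface `t′/t` (object E, at the row's own Fermi energy) lies in `[-0.3091, -0.159]`.** Lower closure: monotone. [folklore] -/
theorem la214Box_fsRatio_x0125 {Δ a b c : ℝ} (hΔ : Δ ∈ Icc ((17 : ℝ) / 10) 4) (ha : a ∈ Icc ((129 : ℝ) / 100) ((38 : ℝ) / 25)) (hb : b ∈ Icc ((23 : ℝ) / 50) ((33 : ℝ) / 50)) (hc : c ∈ Icc ((3 : ℝ) / 25) ((3 : ℝ) / 20)) :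
    fsRatio Δ a b c (fermiEnergyOf Δ a b c ((7 : ℝ) / 16)) ∈ Icc ((-3091 : ℝ) / 10000) ((-159 : ℝ) / 1000) := by
  have hV : ((3 : ℝ) / 20) * ((33 : ℝ) / 50) / ((23 : ℝ) / 50) = (99 : ℝ) / 460 := by norm_num
  have hW : ((3 : ℝ) / 25) * ((23 : ℝ) / 50) / ((33 : ℝ) / 50) = (23 : ℝ) / 275 := by norm_num
  -- certificates (K = 384 point brackets)
  have hVlo := (fermiEnergyOf_of_pointBracketCheck virtPt_la214Vlo_x0125_br (by norm_num) (by norm_num) (by norm_num) (ν := (7/16 : ℝ)) (by push_cast; exact ⟨le_rfl, le_rfl⟩)).2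
  have hVhi := (fermiEnergyOf_of_pointBracketCheck virtPt_la214Vhi_x0125_br (by norm_num) (by norm_num) (by norm_num) (ν := (7/16 : ℝ)) (by push_cast; exact ⟨le_rfl, le_rfl⟩)).2
  have hAlo := (fermiEnergyOf_of_pointBracketCheck virtPt_la214Alo_x0125_br (by norm_num) (by norm_num) (by norm_num) (ν := (7/16 : ℝ)) (by push_cast; exact ⟨le_rfl, le_rfl⟩)).2
  have hTop := (fermiEnergyOf_of_pointBracketCheck cornerPt_la214BoxHi_x0125_br (by norm_num) (by norm_num) (by norm_num) (ν := (7/16 : ℝ)) (by push_cast; exact ⟨le_rfl, le_rfl⟩)).2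
  push_cast at hVlo hVhi hAlo hTop
  norm_num at hVlo hVhi hAlo hTop
  refine fsRatio_fermiEnergyOf_mem_Icc_windowClosure (Δ₁ := (17 : ℝ) / 10) (Δ₂ := 4) (a₁ := (129 : ℝ) / 100) (a₂ := (38 : ℝ) / 25) (b₁ := (23 : ℝ) / 50)
    (b₂ := (33 : ℝ) / 50) (c₁ := (3 : ℝ) / 25) (c₂ := (3 : ℝ) / 20) (e₁ := ((17397 : ℝ) / 10000)) (e₂ := ((3683 : ℝ) / 2000)) (e₃ := 0) (e₄ := ((63 : ℝ) / 40)) (by norm_num) (by norm_num) (by norm_num) (by norm_num)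
    (by norm_num) hΔ ha hb hc (by norm_num) (by norm_num) ?_ ?_ ?_ (by norm_num) ?_ ?_ ?_ (by norm_num) ?_
  · -- regime at the box's Fermi-energy high corner (g34 certificate): c₂ b₂ ε_F(Δ₁, a₂, b₂, c₁) ≤ a₁² b₁
    nlinarith [hTop.2]
  · rw [hV]; exact hVlo.1
  · exact hAlo.2
  · intro ε hε
    rw [hV]
    have hmono := (fsRatio_mem_Icc_on_window_of_dopingDisc_nonpos (Δ := (17 : ℝ) / 10) (a := (129 : ℝ) / 100) (b := (33 : ℝ) / 50) (c := (99 : ℝ) / 460)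
      (p := ((17397 : ℝ) / 10000)) (q := ((3683 : ℝ) / 2000)) (by norm_num) (by norm_num) (by norm_num) (by norm_num) (by norm_num) (by norm_num) (by norm_num)
      (by norm_num [dopingDisc]) hε).1
    refine le_trans ?_ hmono
    norm_num [fsRatio, fsD, fsN]
  · exact (fermiEnergyOf_pos (by norm_num) (by norm_num) (by norm_num) (by norm_num) (by norm_num) (by norm_num)).le
  · rw [hW]; exact hVhi.2
  · intro ε hε
    rw [hW]
    have hmono := (fsRatio_mem_Icc_on_window_of_dopingDisc_nonpos (Δ := (4 : ℝ)) (a := (38 : ℝ) / 25) (b := (23 : ℝ) / 50) (c := (23 : ℝ) / 275)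
      (p := 0) (q := ((63 : ℝ) / 40)) (by norm_num) (by norm_num) (by norm_num) (by norm_num) (by norm_num) (by norm_num) (by norm_num)
      (by norm_num [dopingDisc]) hε).2
    refine le_trans hmono ?_
    norm_num [fsRatio, fsD, fsN]

/-- **x = 0.22 (ν = 39/100; M17 centre): for every row of the La₂CuO₄ 3BE box the one-band Fermi-surface `t′/t` (object E, at the row's own Fermi energy) lies in `[-0.3093, -0.1595]`.** Lower closure: monotone. [folklore] -/
theorem la214Box_fsRatio_x022 {Δ a b c : ℝ} (hΔ : Δ ∈ Icc ((17 : ℝ) / 10) 4) (ha : a ∈ Icc ((129 : ℝ) / 100) ((38 : ℝ) / 25)) (hb : b ∈ Icc ((23 : ℝ) / 50) ((33 : ℝ) / 50)) (hc : c ∈ Icc ((3 : ℝ) / 25) ((3 : ℝ) / 20)) :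
    fsRatio Δ a b c (fermiEnergyOf Δ a b c ((39 : ℝ) / 100)) ∈ Icc ((-3093 : ℝ) / 10000) ((-319 : ℝ) / 2000) := by
  have hV : ((3 : ℝ) / 20) * ((33 : ℝ) / 50) / ((23 : ℝ) / 50) = (99 : ℝ) / 460 := by norm_num
  have hW : ((3 : ℝ) / 25) * ((23 : ℝ) / 50) / ((33 : ℝ) / 50) = (23 : ℝ) / 275 := by norm_num
  -- certificates (K = 384 point brackets)
  have hVlo := (fermiEnergyOf_of_pointBracketCheck virtPt_la214Vlo_x022_br (by norm_num) (by norm_num) (by norm_num) (ν := (39/100 : ℝ)) (by push_cast; exact ⟨le_rfl, le_rfl⟩)).2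
  have hVhi := (fermiEnergyOf_of_pointBracketCheck virtPt_la214Vhi_x022_br (by norm_num) (by norm_num) (by norm_num) (ν := (39/100 : ℝ)) (by push_cast; exact ⟨le_rfl, le_rfl⟩)).2
  have hAlo := (fermiEnergyOf_of_pointBracketCheck virtPt_la214Alo_x022_br (by norm_num) (by norm_num) (by norm_num) (ν := (39/100 : ℝ)) (by push_cast; exact ⟨le_rfl, le_rfl⟩)).2
  have hTop := (fermiEnergyOf_of_pointBracketCheck cornerPt_la214BoxHi_x022_br (by norm_num) (by norm_num) (by norm_num) (ν := (39/100 : ℝ)) (by push_cast; exact ⟨le_rfl, le_rfl⟩)).2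
  push_cast at hVlo hVhi hAlo hTop
  norm_num at hVlo hVhi hAlo hTop
  refine fsRatio_fermiEnergyOf_mem_Icc_windowClosure (Δ₁ := (17 : ℝ) / 10) (Δ₂ := 4) (a₁ := (129 : ℝ) / 100) (a₂ := (38 : ℝ) / 25) (b₁ := (23 : ℝ) / 50)
    (b₂ := (33 : ℝ) / 50) (c₁ := (3 : ℝ) / 25) (c₂ := (3 : ℝ) / 20) (e₁ := ((8223 : ℝ) / 5000)) (e₂ := ((17429 : ℝ) / 10000)) (e₃ := 0) (e₄ := ((15093 : ℝ) / 10000)) (by norm_num) (by norm_num) (by norm_num) (by norm_num)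
    (by norm_num) hΔ ha hb hc (by norm_num) (by norm_num) ?_ ?_ ?_ (by norm_num) ?_ ?_ ?_ (by norm_num) ?_
  · -- regime at the box's Fermi-energy high corner (g34 certificate): c₂ b₂ ε_F(Δ₁, a₂, b₂, c₁) ≤ a₁² b₁
    nlinarith [hTop.2]
  · rw [hV]; exact hVlo.1
  · exact hAlo.2
  · intro ε hε
    rw [hV]
    have hmono := (fsRatio_mem_Icc_on_window_of_dopingDisc_nonpos (Δ := (17 : ℝ) / 10) (a := (129 : ℝ) / 100) (b := (33 : ℝ) / 50) (c := (99 : ℝ) / 460)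
      (p := ((8223 : ℝ) / 5000)) (q := ((17429 : ℝ) / 10000)) (by norm_num) (by norm_num) (by norm_num) (by norm_num) (by norm_num) (by norm_num) (by norm_num)
      (by norm_num [dopingDisc]) hε).1
    refine le_trans ?_ hmono
    norm_num [fsRatio, fsD, fsN]
  · exact (fermiEnergyOf_pos (by norm_num) (by norm_num) (by norm_num) (by norm_num) (by norm_num) (by norm_num)).le
  · rw [hW]; exact hVhi.2
  · intro ε hε
    rw [hW]
    have hmono := (fsRatio_mem_Icc_on_window_of_dopingDisc_nonpos (Δ := (4 : ℝ)) (a := (38 : ℝ) / 25) (b := (23 : ℝ) / 50) (c := (23 : ℝ) / 275)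
      (p := 0) (q := ((15093 : ℝ) / 10000)) (by norm_num) (by norm_num) (by norm_num) (by norm_num) (by norm_num) (by norm_num) (by norm_num)
      (by norm_num [dopingDisc]) hε).2
    refine le_trans hmono ?_
    norm_num [fsRatio, fsD, fsN]

/-- **Box form (M13, x = 0): for every member `p` of the typed box `emeryBoxLa214` the one-band Fermi-surface `t′/t` of the σ row at half filling per spin
lies in `[-0.3091, -0.1583]`.** [folklore] -/
theorem emeryBoxLa214_fsRatio_x0 (p : EmeryCoord → ℝ) (hp : emeryBoxLa214.Mem p) :
    fsRatio (p .DeltaPd) (p .tpd) (p .tpp) (p .tppP) (fermiEnergyOf (p .DeltaPd) (p .tpd) (p .tpp) (p .tppP) (1/2)) ∈ Icc ((-3091 : ℝ) / 10000) ((-1583 : ℝ) / 10000) := by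
  have h := (emeryBoxLa214_mem_iff p).1 hp
  push_cast at h
  obtain ⟨h1, h2, h3, h4, h5, h6, h7, h8, -⟩ := h
  have := la214Box_fsRatio_x0 (Δ := p .DeltaPd) (a := p .tpd) (b := p .tpp) (c := p .tppP) ⟨by linarith, by linarith⟩ ⟨by linarith, by linarith⟩ ⟨by linarith, by linarith⟩ ⟨by linarith, by linarith⟩
  norm_num at this ⊢
  exact this

end Summit.Ventures.CertifiedManyBodySolver.Downfold.Emery
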